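import Literature.IUT.HodgeTheaters.PiAvatarToFlStar
import Literature.IUT.HodgeTheaters.PiAvatarFlStarInvolutions
import Literature.IUT.HodgeTheaters.PiAvatarGlobalInvolution
import HarnessLib

/-!
# (I2)(i) at the genuine `𝒟^{⊚±}`: every automorphism induced by `Π_{C̲_K}` — in particular the `±` deck involution of
# `𝒟^{⊚±} → 𝒟^⊚` — has trivial `toFlStar` (lies in `Aut_±(𝒟^{⊚±})`) (proof-only over `PiAvatarToFlStar` + abc-iut-L5-t13's
# `PiAvatarFlStarInvolutions`)

S. Mochizuki, *Inter-universal Teichmüller theory I*, kurims manuscript (May 2020), Def 6.1 (v) p. 158 («`Aut_±(𝒟^{⊚±})` …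
contains `Aut_K(X̲_K)`»; the covering `X̲_K → C̲_K` is defined over `K`, so its deck involution is a `K`-automorphism), Ex 6.3 (i)
([IUTchI] Def 6.1 (v) p.158) [claim: Mochizuki2012, status: disputed] (D-0012 claim key, series status DISPUTED — kernel theorems
over abc-iut-L5-t2's REAL `InitialThetaData`; nothing of the series is asserted, no side is taken on [IUTchIII] Cor. 3.12).

`InitialThetaData.toFlStarGlobal_eq_one_of_mem_PiCund`: for `c ∈ Π_{C̲_K}` (which normalises `Π_{X̲_K}`, index `2`),
`toFlStarGlobal (xΠ ↦ xcΠ) = 1` — by abc-iut-L5-t13's `toFlStarOfNormalizer_eq_one_of_mem_of_relIndex_two` (p425312: `c·c ∈ Π_{X̲_K}`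
forces the conjugation exponent to be `±1`) at `C := Π_{C̲_K}`, `[Π_{C̲_K} : Π_{X̲_K}] = 2` (t4 `piXund_relIndex_piCund`).  Hence the
`±` involution `ι` of `PiAvatarGlobalInvolution.exists_globalInvolution` is in `Aut_± = ker toFlStar` (`exists_globalInvolution_mem_ker`).
-/

namespace Literature.IUT.HodgeTheaters

open CategoryTheory

universe u v w

section ToFlStarInvolution

variable {F : Type u} {K : Type v} {Fbar : Type w} [Field F] [NumberField F] [Field K] [NumberField K]
  [Algebra F K] [Field Fbar] [Algebra F Fbar] [Algebra K Fbar]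
  {E : WeierstrassCurve F} [E.IsElliptic] {l : ℕ} {Pb : BadPlacePredicates K}
  (D : InitialThetaData F K Fbar E l Pb) [Fact l.Prime] [(D.PiXund.subgroupOf D.PiXK).Normal]

namespace InitialThetaData

/-- **(I2)(i)** Every automorphism of `𝒟^{⊚±}` induced by an element of `Π_{C̲_K}` has trivial `toFlStar`, i.e. lies in
`Aut_±(𝒟^{⊚±})` ([IUTchI] Def 6.1 (v): `Aut_± ⊇ Aut_K(X̲_K) ∋` the deck involution of `X̲_K → C̲_K`).
([IUTchI] Def 6.1 (v) p.158) [claim: Mochizuki2012, status: disputed] -/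
theorem toFlStarGlobal_eq_one_of_mem_PiCund (c : D.PiC) (hc : c ∈ D.PiCund) :
    D.toFlStarGlobal (OrbitCat.autOfNormalizer c (D.piCund_le_normalizer_piXund hc)) = 1 := by
  rw [toFlStarGlobal_autOfNormalizer, inv_eq_one]
  exact toFlStarOfNormalizer_eq_one_of_mem_of_relIndex_two D.PiXund_le_PiXK D.PiXund_relIndex_PiXK
    D.piXund_relIndex_piCund (D.normalizerIncl ⟨c, D.piCund_le_normalizer_piXund hc⟩) hc

/-- **The `±` involution lies in `Aut_±`**: there is `ι ∈ Aut(𝒟^{⊚±})`, induced by some `a ∈ Π_{C̲_K} ∖ Π_{X̲_K}`, with `ι ≠ 1`,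
`ι² = 1` and `toFlStar ι = 1` (t4 `exists_globalInvolution` + the previous theorem). ([IUTchI] Def 6.1 (v) p.158) [claim: Mochizuki2012, status: disputed] -/
theorem exists_globalInvolution_mem_ker :
    ∃ (a : D.PiC) (ha : a ∈ Subgroup.normalizer ((D.PiXund : Subgroup D.PiC) : Set D.PiC)),
      a ∈ D.PiCund ∧ a ∉ D.PiXund ∧
      OrbitCat.autOfNormalizer a ha ≠ Iso.refl _ ∧
      OrbitCat.autOfNormalizer a ha ≪≫ OrbitCat.autOfNormalizer a ha = Iso.refl _ ∧
      D.toFlStarGlobal (OrbitCat.autOfNormalizer a ha) = 1 := by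
  obtain ⟨a, ha, haC, haX, hne, hsq⟩ := D.exists_globalInvolution
  have h1 := D.toFlStarGlobal_eq_one_of_mem_PiCund a haC
  exact ⟨a, ha, haC, haX, hne, hsq, h1⟩

end InitialThetaData

end ToFlStarInvolution

end Literature.IUT.HodgeTheaters
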